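import Literature.Combinatorics.Enumerative.MultivariateAperyNumbers
import Mathlib.Tactic
import HarnessLib

/-!
# Straub 2014, §5: Lemma 5.5 for natural arguments and the digitwise reduction of the companion product `C(p^r 𝐧; k)`

Topic `Literature/Combinatorics/Enumerative`, namespace `Literature.Combinatorics.Enumerative.MultivariateAperyPrimePowerProofs`
(files `MultivariateAperyDigitReductionProofs` → `MultivariateAperyGZeroProofs`, and
`MultivariateAperyJacobsthalRatioProofs`, → `MultivariateAperyPrimePowerProofs`). PROOF FILE: sorry-free
theorems only — no definition, no named fact. Source read on the page (held text `paper:arxiv-1401.0854`,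
§5, pp. 11–14): A. Straub, *Multivariate Apéry numbers and supercongruences of rational functions*, Algebra &
Number Theory **8** (2014) 1985–2008 [Straub2014]. These four files prove, for `𝐧 ∈ ℤ_{≥0}^4`, the named fact
`MultivariateAperyNumbers.theorem12` (Theorem 1.2 (9): `A(p^r 𝐧) ≡ A(p^{r−1} 𝐧) (mod p^{3r})`, `p ≥ 5`,
`r ≥ 1`) and hence `MultivariateAperyNumbers.coster1988_supercongruence` (Coster 1988:
`A(p^r m) ≡ A(p^{r−1} m) (mod p^{3r})` for the Apéry numbers), along the PRINTED route (Lemmas 5.1–5.6); the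
tree already holds Lemmas 5.2, 5.4 and 5.6 (`MultivariateAperyNumbers.lemma52/lemma54/sum_block_dvd`) and,
as of the sibling files `NumberTheory/Congruences/Jacobsthal*`, Lemma 5.1 (Jacobsthal's congruence).
HONEST FRAMING (cell pub-zeta5): classical prime-power supercongruences for the Apéry numbers of `ζ(3)`;
nothing here concerns `ζ(5)` or any irrationality statement.

## What is printed (verbatim, [Straub2014] §5)

* «Lemma 5.5. For primes `p`, integers `m₁, m₂, k` and integers `r ≥ 1`,
  `C(p^r m₁ + p^r m₂ − k − 1, p^r m₁) ≡ C(p^{r−1} m₁ + p^{r−1} m₂ − [k/p] − 1, p^{r−1} m₁) (mod p^r)`.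
  Proof. By an application of (11) … the claimed congruence therefore follows from (44) and Lemma 5.4.»
  with (44) «`[(p^r m − k − 1)/p] = p^{r−1} m + [−(k+1)/p] = p^{r−1} m − [k/p] − 1`».
* (proof of Theorem 1.2) «Using the basic identity `C(m₁, k) = (m₁/k) C(m₁ − 1, k − 1)`, it is clear that the
  numbers `B_λ(𝐧; k) = k²/(n₁ n_{1+λ₁}) · A_λ(𝐧; k)` are integers. Moreover, it follows from Lemmas 5.4 and 5.5,
  and the fact that `ℓ = 2`, that the integers `C_λ(𝐧; k) = B_λ(𝐧; k + 1)` satisfy, for all `k, r ∈ ℤ` with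
  `r ≥ 0`, `C(p^r 𝐧; k) ≡ C(p^{r−1} 𝐧; [k/p]) (mod p^r)`.»

## What is proved here (λ = (2,2), `𝐧 ∈ ℤ_{≥0}^4`; natural-number arguments, truncated subtraction)

* `ascFactorial_split`, `choose_add_mul_prod_eq`, **`choose_add_modEq`** — the ASCENDING digit reduction
  `C(pN + j, j) ≡ C(N + [j/p], [j/p]) (mod p^r)` for `p^r ∣ pN` (the splitting of the printed proof of
  Lemma 5.4, tree `factorial_split`, applied to the rising factorial) — for naturals this replaces the
  passage through negative arguments ((11), Lemma 5.4 with `k < 0`) in the printed proof of Lemma 5.5;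
* `sub_one_sub_div` — (44); **`lemma55`** (`lemma55_core`) — Lemma 5.5 for `m₁, m₂, k ≥ 0`;
* **`companion_modEq`** — `C(p^r 𝐧; k) ≡ C(p^{r−1} 𝐧; [k/p]) (mod p^r)` for
  `C(𝐦; k) = C(m₁−1, k) C(m₃−1, k) C(m₁+m₂−k−1, m₁) C(m₃+m₄−k−1, m₃)`, `r ≥ 1`, `n₁, n₃ ≥ 1`, from the tree's
  `lemma54` (twice; the signs `(−1)^k` square away — «the fact that `ℓ = 2`») and `lemma55` (twice).
-/

open Finset

namespace Literature.Combinatorics.Enumerative.MultivariateAperyPrimePowerProofs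

open MultivariateAperyNumbers (factorial_split lemma54)

/-! ### §1. The ascending digit reduction and Lemma 5.5 -/

section Ascending

/-- Splitting the rising factorial `(pN + 1)(pN + 2)⋯(pN + j)` according to `p ∣ i` or not:
`= (∏_{i ≤ j, p ∤ i} (pN + i)) · p^{[j/p]} · (N + 1)(N + 2)⋯(N + [j/p])`.
[cite: Straub2014, Lemma 5.4 (proof, the splitting) and Lemma 5.5] -/
theorem ascFactorial_split (p : ℕ) (hp : 0 < p) (N : ℕ) : ∀ j : ℕ,
    (p * N + 1).ascFactorial j =
      (∏ i ∈ range j, if p ∣ i + 1 then 1 else (p * N + (i + 1))) * (p ^ (j / p) * (N + 1).ascFactorial (j / p))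
  | 0 => by simp [Nat.div_eq_of_lt hp]
  | j + 1 => by
    rw [Nat.ascFactorial_succ, ascFactorial_split p hp N j, prod_range_succ]
    by_cases h : p ∣ j + 1
    · rw [if_pos h, Nat.succ_div_of_dvd h, Nat.ascFactorial_succ, pow_succ]
      obtain ⟨c, hc⟩ := h
      have hc' : j / p + 1 = c := by
        rw [← Nat.succ_div_of_dvd ⟨c, hc⟩, hc, Nat.mul_div_cancel_left _ hp]
      have h1 : p * N + 1 + j = p * (N + c) := by rw [Nat.mul_add, ← hc]; omega
      have h2 : N + 1 + j / p = N + c := by omega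
      rw [h1, h2]; ring
    · rw [if_neg h, Nat.succ_div_of_not_dvd h]
      have h1 : p * N + 1 + j = p * N + (j + 1) := by omega
      rw [h1]; ring

/-- The splitting as an exact identity over `ℕ`:
`C(pN + j, j) · ∏_{p∤i≤j} i = (∏_{p∤i≤j} (pN + i)) · C(N + [j/p], [j/p])`. [cite: Straub2014, Lemma 5.5 (proof)] -/
theorem choose_add_mul_prod_eq (p : ℕ) (hp : 0 < p) (N j : ℕ) :
    (p * N + j).choose j * (∏ i ∈ range j, if p ∣ i + 1 then 1 else (i + 1)) =
      (∏ i ∈ range j, if p ∣ i + 1 then 1 else (p * N + (i + 1))) * (N + j / p).choose (j / p) := by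
  have h1 := ascFactorial_split p hp N j
  rw [Nat.ascFactorial_eq_factorial_mul_choose, Nat.ascFactorial_eq_factorial_mul_choose,
    factorial_split p hp j] at h1
  have hpos : 0 < p ^ (j / p) * (j / p).factorial := by positivity
  apply Nat.eq_of_mul_eq_mul_left hpos
  calc p ^ (j / p) * (j / p).factorial * ((p * N + j).choose j * ∏ i ∈ range j, if p ∣ i + 1 then 1 else (i + 1))
      = (∏ i ∈ range j, if p ∣ i + 1 then 1 else (i + 1)) * (p ^ (j / p) * (j / p).factorial) *
          (p * N + j).choose j := by ring
    _ = (∏ i ∈ range j, if p ∣ i + 1 then 1 else (p * N + (i + 1))) *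
          (p ^ (j / p) * ((j / p).factorial * (N + j / p).choose (j / p))) := by
        rw [h1]
    _ = p ^ (j / p) * (j / p).factorial *
          ((∏ i ∈ range j, if p ∣ i + 1 then 1 else (p * N + (i + 1))) * (N + j / p).choose (j / p)) := by ring

/-- **Ascending digit reduction** (the content of Lemma 5.5): for a prime `p`, `p^r ∣ pN` and all `j`,
`C(pN + j, j) ≡ C(N + [j/p], [j/p]) (mod p^r)`. [cite: Straub2014, Lemma 5.5 (proof)] -/
theorem choose_add_modEq {p : ℕ} (hp : p.Prime) (r : ℕ) {N : ℕ} (hdiv : p ^ r ∣ p * N) (j : ℕ) :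
    (((p * N + j).choose j : ℕ) : ℤ) ≡ ((N + j / p).choose (j / p) : ℕ) [ZMOD (p : ℤ) ^ r] := by
  have hp0 : 0 < p := hp.pos
  have hmod : ((p : ℤ) ^ r) = ((p ^ r : ℕ) : ℤ) := by push_cast; rfl
  rw [hmod, ← ZMod.intCast_eq_intCast_iff]
  push_cast
  have hpN : ((p * N : ℕ) : ZMod (p ^ r)) = 0 := by
    rw [ZMod.natCast_eq_zero_iff]; exact hdiv
  have hII := congrArg (fun x : ℕ => (x : ZMod (p ^ r))) (choose_add_mul_prod_eq p hp0 N j)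
  simp only [Nat.cast_mul, Nat.cast_prod] at hII
  have hQ : (∏ i ∈ range j, ((if p ∣ i + 1 then 1 else (p * N + (i + 1)) : ℕ) : ZMod (p ^ r))) =
      ∏ i ∈ range j, ((if p ∣ i + 1 then 1 else (i + 1) : ℕ) : ZMod (p ^ r)) := by
    apply Finset.prod_congr rfl
    intro i _
    split_ifs with h
    · rfl
    · push_cast
      rw [← Nat.cast_mul, hpN, zero_add]
  have hPu : IsUnit (∏ i ∈ range j, ((if p ∣ i + 1 then 1 else (i + 1) : ℕ) : ZMod (p ^ r))) := by
    apply Finset.prod_induction _ IsUnit (fun a b ha hb => ha.mul hb) isUnit_one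
    intro i _
    split_ifs with h
    · simp
    · have hcop : Nat.Coprime (i + 1) (p ^ r) :=
        Nat.Coprime.pow_right _ (Nat.coprime_comm.mp ((Nat.Prime.coprime_iff_not_dvd hp).mpr h))
      have hu := Units.isUnit (ZMod.unitOfCoprime (i + 1) hcop)
      rwa [ZMod.coe_unitOfCoprime] at hu
  rw [hQ, mul_comm (∏ i ∈ range j, _)] at hII
  exact (IsUnit.mul_left_inj hPu).mp hII

/-- The digit identity (44): `[(pM − 1 − j)/p] = M − 1 − [j/p]` for `j < pM`. [cite: Straub2014, Lemma 5.4 (44)] -/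
theorem sub_one_sub_div {p : ℕ} (hp : 0 < p) {M j : ℕ} (hj : j < p * M) :
    (p * M - 1 - j) / p = M - 1 - j / p := by
  have hqM : j / p < M := (Nat.div_lt_iff_lt_mul hp).mpr (by rw [mul_comm]; exact hj)
  have hρ : j % p < p := Nat.mod_lt j hp
  have hdm : p * (j / p) + j % p = j := Nat.div_add_mod j p
  have key : p * M - 1 - j = p * (M - 1 - j / p) + (p - 1 - j % p) := by
    have h1 : p * (M - 1 - j / p) = p * M - p - p * (j / p) := by
      rw [Nat.mul_sub, Nat.mul_sub, Nat.mul_one]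
    have h2 : p * (j / p) + p ≤ p * M := by
      have := Nat.mul_le_mul_left p (show j / p + 1 ≤ M by omega)
      rwa [Nat.mul_add, Nat.mul_one] at this
    omega
  rw [key, Nat.mul_add_div hp, Nat.div_eq_of_lt (by omega : p - 1 - j % p < p), add_zero]

/-- Lemma 5.5 with the modulus decoupled: for a prime `p`, `p^r ∣ pN₁` and all `N₂, k`,
`C(pN₁ + pN₂ − k − 1, pN₁) ≡ C(N₁ + N₂ − [k/p] − 1, N₁) (mod p^r)`. [cite: Straub2014, Lemma 5.5] -/
theorem lemma55_core {p : ℕ} (hp : p.Prime) (r : ℕ) {N₁ : ℕ} (hdiv : p ^ r ∣ p * N₁) (N₂ k : ℕ) :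
    (((p * N₁ + p * N₂ - k - 1).choose (p * N₁) : ℕ) : ℤ) ≡
      ((N₁ + N₂ - k / p - 1).choose N₁ : ℕ) [ZMOD (p : ℤ) ^ r] := by
  have hp0 : 0 < p := hp.pos
  rcases Nat.lt_or_ge k (p * N₂) with hk | hk
  · -- `k < p N₂`: write `k = p N₂ − 1 − j`
    set j := p * N₂ - 1 - k with hj
    have hjlt : j < p * N₂ := by omega
    have hkj : k = p * N₂ - 1 - j := by omega
    have hkp : k / p = N₂ - 1 - j / p := by rw [hkj]; exact sub_one_sub_div hp0 hjlt
    have hjp : j / p < N₂ := (Nat.div_lt_iff_lt_mul hp0).mpr (by rw [mul_comm]; exact hjlt)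
    have htop1 : p * N₁ + p * N₂ - k - 1 = p * N₁ + j := by omega
    have htop2 : N₁ + N₂ - k / p - 1 = N₁ + j / p := by
      rw [hkp]
      generalize j / p = q at hjp ⊢
      omega
    rw [htop1, htop2, Nat.choose_symm_add, Nat.choose_symm_add]
    exact choose_add_modEq hp r hdiv j
  · -- `k ≥ p N₂`: both sides are `C(top, bottom)` with `top < bottom`, or both are `1` if `N₁ = 0`
    have hkp : N₂ ≤ k / p := by rw [Nat.le_div_iff_mul_le hp0, mul_comm]; exact hk
    rcases Nat.eq_zero_or_pos N₁ with hN | hN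
    · subst hN; simp
    · have hM : 0 < p * N₁ := Nat.mul_pos hp0 hN
      rw [Nat.choose_eq_zero_of_lt (by omega), Nat.choose_eq_zero_of_lt (by omega)]

/-- **Straub 2014, Lemma 5.5** for natural arguments: for a prime `p`, `r ≥ 1` and all `m₁, m₂, k ≥ 0`,
`C(p^r m₁ + p^r m₂ − k − 1, p^r m₁) ≡ C(p^{r−1} m₁ + p^{r−1} m₂ − [k/p] − 1, p^{r−1} m₁) (mod p^r)`
(truncated subtraction; both sides vanish, or both equal `1` when `m₁ = 0`, as soon as `k ≥ p^r m₂`).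
[cite: Straub2014, Lemma 5.5] -/
theorem lemma55 {p : ℕ} (hp : p.Prime) {r : ℕ} (hr : 1 ≤ r) (m₁ m₂ k : ℕ) :
    (((p ^ r * m₁ + p ^ r * m₂ - k - 1).choose (p ^ r * m₁) : ℕ) : ℤ) ≡
      ((p ^ (r - 1) * m₁ + p ^ (r - 1) * m₂ - k / p - 1).choose (p ^ (r - 1) * m₁) : ℕ)
        [ZMOD (p : ℤ) ^ r] := by
  have hN : p ^ r = p * p ^ (r - 1) := by rw [← pow_succ']; congr 1; omega
  rw [hN, mul_assoc, mul_assoc]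
  exact lemma55_core hp r (by rw [hN]; exact mul_dvd_mul_left p (dvd_mul_right _ m₁)) _ k

end Ascending

/-! ### §2. The companion product reduces digitwise -/

section Companion

/-- Squares of signs cancel: `((−1)^n a)((−1)^n b) = ab`. [folklore] -/
private theorem neg_one_pow_mul_mul_neg_one_pow_mul (n : ℕ) (a b : ℤ) :
    (-1) ^ n * a * ((-1) ^ n * b) = a * b := by
  rw [show (-1 : ℤ) ^ n * a * ((-1) ^ n * b) = ((-1) ^ n) ^ 2 * (a * b) by ring, ← pow_mul, mul_comm n 2,
    pow_mul]
  norm_num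

/-- **The companion product reduces digitwise** (Straub, proof of Thm 1.2: «it follows from Lemmas 5.4 and 5.5,
and the fact that `ℓ = 2`, that the integers `C_λ(𝐧; k) = B_λ(𝐧; k+1)` satisfy
`C(p^r 𝐧; k) ≡ C(p^{r−1} 𝐧; [k/p]) (mod p^r)`»), for `λ = (2,2)`: with
`C(𝐦; k) = C(m₁−1, k) C(m₃−1, k) C(m₁+m₂−k−1, m₁) C(m₃+m₄−k−1, m₃)`, for a prime `p`, `r ≥ 1`,
`n₁, n₃ ≥ 1` and every `k ≥ 0`. [cite: Straub2014, Theorem 1.2 (proof) with Lemmas 5.4, 5.5] -/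
theorem companion_modEq {p : ℕ} (hp : p.Prime) {r : ℕ} (hr : 1 ≤ r) {n₁ n₃ : ℕ} (hn₁ : 1 ≤ n₁) (hn₃ : 1 ≤ n₃)
    (n₂ n₄ k : ℕ) :
    (((p ^ r * n₁ - 1).choose k * (p ^ r * n₃ - 1).choose k *
        (p ^ r * n₁ + p ^ r * n₂ - k - 1).choose (p ^ r * n₁) *
        (p ^ r * n₃ + p ^ r * n₄ - k - 1).choose (p ^ r * n₃) : ℕ) : ℤ) ≡
      (((p ^ (r - 1) * n₁ - 1).choose (k / p) * (p ^ (r - 1) * n₃ - 1).choose (k / p) *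
        (p ^ (r - 1) * n₁ + p ^ (r - 1) * n₂ - k / p - 1).choose (p ^ (r - 1) * n₁) *
        (p ^ (r - 1) * n₃ + p ^ (r - 1) * n₄ - k / p - 1).choose (p ^ (r - 1) * n₃) : ℕ) : ℤ)
      [ZMOD (p : ℤ) ^ r] := by
  have h1 := lemma54 hp hr hn₁ k
  have h3 := lemma54 hp hr hn₃ k
  have h13 := h1.mul h3
  rw [neg_one_pow_mul_mul_neg_one_pow_mul, neg_one_pow_mul_mul_neg_one_pow_mul] at h13
  have h2 := lemma55 hp hr n₁ n₂ k
  have h4 := lemma55 hp hr n₃ n₄ k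
  have := (h13.mul h2).mul h4
  push_cast at this ⊢
  simpa [mul_assoc] using this

end Companion

end Literature.Combinatorics.Enumerative.MultivariateAperyPrimePowerProofs
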